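import Summits.Ventures.HSemireg.MethodInstanceG6ThetaSecantReachLaw
import HarnessLib

/-!
# Venture HSemireg — REACH CERTIFICATES for the g = 6 theta-secant method instance: the classical 2-descent decides, for every odd `d`,
# whether `ℚ(√-d)` is reached — by a YES witness `(m, k)` or a NO certificate `(a, b, u, v)`, `a·b = d`, `1 < b`, `b·v² = a·u² + 1`

HONEST FRAMING. Lean index of the computation cell `pub-hsemireg` (seat p8, «Sunday typer § g = 6»; sequel of
`MethodInstanceG6ThetaSecantReachLaw.lean`). ELEMENTARY NUMBER THEORY only (Pell descent); no variety, sheaf or `Ext` group is constructed and no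
Weil-class statement is made in this file. Nothing here says HC, HC_CM or HC_AV is proved; the reach concerns SPLIT sixfold components (method
instances; the verdict's deciding rows stay «NO-in-families-tried», candidates 0).

WHAT IT ADDS to the reach law («`ℚ(√-d)` reached by some `𝓕_m` ⟺ the fundamental solution of `x² − d·y² = 1` has `y` odd ⟺ has `x` even»,
`MethodInstanceG6ThetaSecantReachLaw.lean` §2): a CERTIFICATE for the NO side that needs no fundamental solution and no search bound.
* §1 DESCENT (`pell_certificate_of_odd_fundamental_x`): for odd `d`, if the fundamental `x₁` is ODD then, writing `x₁ = 2t + 1`, `y₁ = 2w`,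
  `t·(t + 1) = d·w²` splits along `gcd` as `t = a·u²`, `t + 1 = b·v²` with `a·b = d`, and `1 < b` (else `(v, u)` would be a smaller solution):
  a certificate `b·v² − a·u² = 1`, `a·b = d`, `1 < b`. CONVERSELY (`pell_odd_fundamental_x_of_certificate`) such a certificate forces `x₁` odd: the
  solution `(2b·v² − 1, 2u·v)` has odd `x`, so it is `± a₁^{2j} = ± (a₁^j)²`, whence `b·v² = x_j²`, `u² = b·y_j²`, and `gcd(b, u) = 1` gives `b = 1`.
  (For a PRIME `d = p` only `b = p`, `a = 1` is available, i.e. `u² ≡ -1 (mod p)` — the predecessor's `pell_even_x_of_isFundamental_of_prime`.)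
* §2 ℕ-CURRENCY: `thetaSecant_noReach_of_certificate` — for odd `d`, a certificate `(a, b, u, v)` implies NO even `m` has `m² = d·k² + 1` (and
  every such `k` is even); `thetaSecant_reach_or_certificate` / `thetaSecant_reach_iff_no_certificate` — for odd non-square `d` EXACTLY ONE of
  «YES witness `(m, k)`, `m` even» / «NO certificate `(a, b, u, v)`» exists: reach is decided by a finite certificate either way (`…_of_mod_four_eq_three`: the cell's case `d ≡ 3 (4)`; primes admit no
  certificate, `thetaSecant_no_certificate_of_prime`).
* §3 THE TABLE BY CERTIFICATE: the predecessor's NO-list `d ∈ {39, 55, 95, 111}` (there: fundamental solutions certified by `interval_cases`) now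
  follows from the four certificates `(a,b,u,v) = (3,13,2,1), (11,5,2,3), (19,5,1,2), (3,37,7,2)` in one line each, and the table EXTENDS to all
  squarefree `d ≡ 3 (mod 4)`, `d < 200`: primes by `thetaSecant_reaches_prime` (no data), composites `123, 143, 159, 187, 195` YES by witnesses
  `(122,11), (12,1), (1324,105), (1682,123), (14,1)`, and `155, 183` NO by certificates `(31,5,2,5), (3,61,9,2)` — so up to `200` the fields NOT
  reached are exactly `d ∈ {39, 55, 95, 111, 155, 183}` (`thetaSecant_noList_by_certificate`, `thetaSecant_yesList_composite_lt_200`); and a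
  kernel NEGATIVE CONTROL: «prime» cannot be dropped from the predecessor's prime theorem — `d = 39` has fundamental `(25, 4)`, `x` odd
  (`pell_fundamental_x_odd_39`, `not_forall_mod_four_eq_three_fundamental_x_even`).
Source of the sentence: `step0/THETA-SECANT-p1.md` v2.6 §1 «COVERAGE (Pell)»; census `target-g6/CENSUS.md` row D-2 REACH cell. 0 `def`, 0 `sorry`,
0 named fact.
-/

noncomputable section

open CategoryTheory AlgebraicGeometry
open Literature.AlgebraicGeometry.Motives Literature.AlgebraicGeometry.HodgeTheory
open Literature.AlgebraicGeometry.ModuliOfAbelianVarieties Literature.AlgebraicGeometry.Deligne1982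
open Literature.AlgebraicGeometry.KTheory
open Literature.AlgebraicTopology.SingularHomology

namespace Summit.Ventures.HSemireg

section PellDescent

open Pell

/-! ## §1 The 2-descent: odd fundamental `x` ⟺ a certificate `b·v² − a·u² = 1`, `a·b = d`, `1 < b` -/

/-- `x`-coordinate of the square of a solution: `(a·a).x = 2·a.x² − 1`. [bookkeeping] -/
theorem pell_x_mul_self {d : ℤ} (a : Solution₁ d) : (a * a).x = 2 * a.x ^ 2 - 1 := by
  rw [Solution₁.x_mul]
  linear_combination a.prop_y

/-- **DESCENT.** For odd `d`: if the fundamental solution has `x` ODD, there is a certificate `a·b = d`, `0 < a`, `1 < b`, `b·v² − a·u² = 1`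
(`x₁ = 2t + 1`, `y₁ = 2w`, `t(t+1) = d·w²`; `a = gcd(t, d)`, `b = d/a ∣ t + 1`; `t/a`, `(t+1)/b` coprime with square product, so squares; `b = 1` would
make `((t+1)^{1/2}, u)` a solution with `1 < x < x₁`). [bookkeeping] -/
theorem pell_certificate_of_odd_fundamental_x {d : ℤ} (hd : Odd d) {a₁ : Solution₁ d} (h : IsFundamental a₁) (hx : Odd a₁.x) :
    ∃ a b u v : ℤ, a * b = d ∧ 0 < a ∧ 1 < b ∧ b * v ^ 2 - a * u ^ 2 = 1 := by
  have hd0 : d ≠ 0 := h.d_pos.ne'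
  have hyeven : Even a₁.y := by
    by_contra hy
    exact (Int.not_even_iff_odd.2 hx) ((pell_even_x_iff_odd_y hd a₁).2 (Int.not_even_iff_odd.1 hy))
  obtain ⟨t, ht⟩ := hx
  obtain ⟨w, hw⟩ := hyeven
  have hx1 := h.1
  have ht0 : 0 < t := by linarith
  have key : t * (t + 1) = d * w ^ 2 := by
    have e := a₁.prop
    rw [ht, hw] at e
    have e4 : (4 : ℤ) * (t * (t + 1)) = 4 * (d * w ^ 2) := by linear_combination e
    exact mul_left_cancel₀ (by norm_num) e4
  obtain ⟨g, t', d', hg0, hcop, ht', hd'⟩ := Int.exists_gcd_one' (Int.gcd_pos_of_ne_zero_right t hd0)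
  have hg0' : (0 : ℤ) < g := by exact_mod_cast hg0
  have hcop' : IsCoprime t' d' := Int.isCoprime_iff_gcd_eq_one.2 hcop
  have hd'0 : 0 < d' := by
    have : 0 < d' * (g : ℤ) := by rw [← hd']; exact h.d_pos
    by_contra hle
    push Not at hle
    nlinarith
  have ht'0 : 0 < t' := by
    have : 0 < t' * (g : ℤ) := by rw [← ht']; exact ht0
    by_contra hle
    push Not at hle
    nlinarith
  have key' : t' * (t + 1) = d' * w ^ 2 := by
    have e : (g : ℤ) * (t' * (t + 1)) = g * (d' * w ^ 2) := by
      calc (g : ℤ) * (t' * (t + 1)) = t * (t + 1) := by rw [ht']; ring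
        _ = d * w ^ 2 := key
        _ = g * (d' * w ^ 2) := by rw [hd']; ring
    exact mul_left_cancel₀ hg0'.ne' e
  obtain ⟨s, hs⟩ : d' ∣ t + 1 := hcop'.symm.dvd_of_dvd_mul_left ⟨w ^ 2, key'⟩
  have hprod : t' * s = w ^ 2 := by
    have e : d' * (t' * s) = d' * w ^ 2 := by rw [← key', hs]; ring
    exact mul_left_cancel₀ hd'0.ne' e
  have hcopts : IsCoprime t' s := by
    have h0 : IsCoprime (t' * (g : ℤ)) (d' * s) := by rw [← ht', ← hs]; exact ⟨-1, 1, by ring⟩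
    exact h0.of_mul_left_left.of_mul_right_right
  obtain ⟨u, hu⟩ := Int.sq_of_isCoprime hcopts hprod
  obtain ⟨v, hv⟩ := Int.sq_of_isCoprime hcopts.symm (by rw [mul_comm]; exact hprod)
  have htu : t' = u ^ 2 := by
    rcases hu with hu | hu
    · exact hu
    · nlinarith [sq_nonneg u]
  have hs0 : 0 < s := by
    have : 0 < d' * s := by rw [← hs]; linarith
    by_contra hle
    push Not at hle
    nlinarith
  have hsv : s = v ^ 2 := by
    rcases hv with hv | hv
    · exact hv
    · nlinarith [sq_nonneg v]
  refine ⟨g, d', u, v, by rw [hd', mul_comm], hg0', ?_, ?_⟩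
  · by_contra hb
    have hd'1 : d' = 1 := by omega
    subst hd'1
    -- `t + 1 = v²`, `t = g·u² = d·u²`: the smaller solution `(|v|, u)`
    have hsol : (|v|) ^ 2 - d * u ^ 2 = 1 := by
      rw [sq_abs, ← hsv, ← htu]
      linear_combination (-1 : ℤ) * hs + ht' - t' * hd'
    have hv2 : v ^ 2 = t + 1 := by rw [← hsv]; linarith
    have hb1 : 1 < |v| := by
      by_contra hle
      push Not at hle
      have : |v| ^ 2 ≤ 1 := by nlinarith [abs_nonneg v]
      rw [sq_abs] at this
      linarith
    have hmin := h.2.2 (show 1 < (Solution₁.mk |v| u hsol).x by rw [Solution₁.x_mk]; exact hb1)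
    rw [Solution₁.x_mk] at hmin
    have hbb : |v| ≤ |v| ^ 2 := by nlinarith [abs_nonneg v]
    rw [sq_abs] at hbb
    linarith
  · rw [← hsv, ← htu]
    linear_combination (-1 : ℤ) * hs + ht'

/-- **CONVERSE.** For odd `d`: a certificate `a·b = d`, `1 < b`, `b·v² − a·u² = 1` forces the fundamental `x` to be ODD (so `ℚ(√-d)` is NOT
reached): otherwise the odd-`x` solution `(2b·v² − 1, 2u·v)` is `(a₁ʲ)²` up to sign, `b·v² = x_j²`, `u² = b·y_j²`, and `gcd(b, u) = 1` gives `b = ±1`.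
[bookkeeping] -/
theorem pell_odd_fundamental_x_of_certificate {d : ℤ} (hd : Odd d) {a₁ : Solution₁ d} (h : IsFundamental a₁) {a b u v : ℤ}
    (hab : a * b = d) (hb : 1 < b) (hc : b * v ^ 2 - a * u ^ 2 = 1) : Odd a₁.x := by
  by_contra hx
  rw [Int.not_odd_iff_even] at hx
  have hd0 : d ≠ 0 := h.d_pos.ne'
  have hv0 : v ≠ 0 := by
    rintro rfl
    have h1 : a * u ^ 2 = -1 := by linear_combination (-1 : ℤ) * hc
    rcases Int.eq_one_or_neg_one_of_mul_eq_neg_one h1 with rfl | rfl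
    · nlinarith [sq_nonneg u]
    · have : b = -d := by linear_combination (-1 : ℤ) * hab
      linarith [h.d_pos]
  let S : Solution₁ d := Solution₁.mk (2 * b * v ^ 2 - 1) (2 * u * v) (by rw [← hab]; linear_combination (4 * b * v ^ 2) * hc)
  have hSx : S.x = 2 * b * v ^ 2 - 1 := Solution₁.x_mk _ _ _
  have hSodd : Odd S.x := by rw [hSx]; exact ⟨b * v ^ 2 - 1, by ring⟩
  have hSpos : 0 < S.x := by
    have hv2 : 0 < v ^ 2 := by positivity
    rw [hSx]
    nlinarith
  obtain ⟨n, hn⟩ := h.eq_zpow_or_neg_zpow S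
  have hneven : Even n := by
    by_contra hne
    exact Int.not_even_iff_odd.2 hSodd ((pell_even_x_iff_odd_exponent hd h hx S).2 ⟨n, Int.not_even_iff_odd.1 hne, hn⟩)
  obtain ⟨j, rfl⟩ := hneven
  have hcc : a₁ ^ (j + j) = a₁ ^ j * a₁ ^ j := zpow_add a₁ j j
  set c := a₁ ^ j with hc_def
  have hcx : (c * c).x = 2 * c.x ^ 2 - 1 := pell_x_mul_self c
  rcases hn with hS | hS
  · rw [hcc] at hS
    have hbv : b * v ^ 2 = c.x ^ 2 := by
      have : S.x = 2 * c.x ^ 2 - 1 := by rw [hS, hcx]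
      linarith
    have hcprop := c.prop
    have hu2 : u ^ 2 = b * c.y ^ 2 := by
      have ha0 : a ≠ 0 := by rintro rfl; rw [zero_mul] at hab; exact hd0 hab.symm
      have e : a * u ^ 2 = a * (b * c.y ^ 2) := by linear_combination (-1 : ℤ) * hc + hbv + hcprop - c.y ^ 2 * hab
      exact mul_left_cancel₀ ha0 e
    obtain ⟨x, y, hxy⟩ : IsCoprime b u := ⟨v ^ 2, -(a * u), by linear_combination hc⟩
    have hunit : b * (x ^ 2 * b + 2 * x * y * u + y ^ 2 * c.y ^ 2) = 1 := by
      linear_combination (x * b + y * u + 1) * hxy - y ^ 2 * hu2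
    rcases Int.eq_one_or_neg_one_of_mul_eq_one hunit with hb1 | hb1 <;> linarith
  · rw [hcc] at hS
    have : S.x = -(2 * c.x ^ 2 - 1) := by rw [hS, Solution₁.x_neg, hcx]
    have hcx0 : c.x ≠ 0 := Solution₁.x_ne_zero h.d_pos.le c
    have : 0 < c.x ^ 2 := by positivity
    linarith

/-! ## §2 ℕ-currency: reach is decided by a certificate on either side -/

/-- A certificate `a·b = d`, `1 < b`, `b·v² = a·u² + 1` in ℕ is one over ℤ. [bookkeeping] -/
theorem pell_certificate_int_of_nat {d a b u v : ℕ} (hab : a * b = d) (hb : 1 < b) (hcert : b * v ^ 2 = a * u ^ 2 + 1) :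
    (a : ℤ) * b = d ∧ (1 : ℤ) < b ∧ (b : ℤ) * (v : ℤ) ^ 2 - a * (u : ℤ) ^ 2 = 1 := by
  refine ⟨by exact_mod_cast hab, by exact_mod_cast hb, ?_⟩
  have hz : ((b * v ^ 2 : ℕ) : ℤ) = ((a * u ^ 2 + 1 : ℕ) : ℤ) := by exact_mod_cast hcert
  push_cast at hz
  linarith

/-- **NO BY CERTIFICATE.** For odd `d`: a certificate `a·b = d`, `1 < b`, `b·v² = a·u² + 1` implies that NO even `m` satisfies `m² = d·k² + 1`,
and every such `k` is even — no theta-secant parameter reaches `ℚ(√-d)`. (Square `d`: only `m = 1`; otherwise §1's converse + the reach law.)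
[bookkeeping] -/
theorem thetaSecant_noReach_of_certificate {d a b u v : ℕ} (hd : Odd d) (hab : a * b = d) (hb : 1 < b)
    (hcert : b * v ^ 2 = a * u ^ 2 + 1) {m k : ℕ} (hmk : m ^ 2 = d * k ^ 2 + 1) : ¬ Even m ∧ Even k := by
  by_cases hsq : IsSquare d
  · obtain ⟨r, hr⟩ := hsq
    have h1 : m ^ 2 = (r * k) ^ 2 + 1 := by rw [hmk, hr]; ring
    obtain ⟨hm, hk⟩ := eq_one_of_sq_eq_sq_add_one h1
    refine ⟨by rw [hm]; exact Nat.not_even_one, ?_⟩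
    rcases Nat.mul_eq_zero.1 hk with h0 | h0
    · subst h0
      rw [mul_zero] at hr
      subst hr
      exact absurd hd (by decide)
    · rw [h0]
      exact Even.zero
  · have hd0 : (0 : ℤ) < d := by exact_mod_cast hd.pos
    obtain ⟨a₁, h⟩ := IsFundamental.exists_of_not_isSquare hd0 (by rwa [Int.isSquare_natCast_iff])
    have hd' : Odd (d : ℤ) := (Int.odd_coe_nat d).2 hd
    obtain ⟨habz, hbz, hcz⟩ := pell_certificate_int_of_nat hab hb hcert
    have hxodd : Odd a₁.x := pell_odd_fundamental_x_of_certificate hd' h habz hbz hcz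
    have hyeven : Even a₁.y := by
      by_contra hy
      exact (Int.not_even_iff_odd.2 hxodd) ((pell_even_x_iff_odd_y hd' a₁).2 (Int.not_even_iff_odd.1 hy))
    exact thetaSecant_noReach_of_even_fundamental_y hd h hyeven hmk

/-- **DICHOTOMY.** For odd non-square `d`: either some EVEN `m` has `m² = d·k² + 1` (YES witness: `ℚ(√-d)` reached), or there is a NO certificate
`a·b = d`, `1 < b`, `b·v² = a·u² + 1`. [bookkeeping] -/
theorem thetaSecant_reach_or_certificate {d : ℕ} (hd : Odd d) (hsq : ¬ IsSquare d) :
    (∃ m k : ℕ, Even m ∧ m ^ 2 = d * k ^ 2 + 1) ∨ (∃ a b u v : ℕ, a * b = d ∧ 1 < b ∧ b * v ^ 2 = a * u ^ 2 + 1) := by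
  have hd0 : (0 : ℤ) < d := by exact_mod_cast hd.pos
  obtain ⟨a₁, h⟩ := IsFundamental.exists_of_not_isSquare hd0 (by rwa [Int.isSquare_natCast_iff])
  rcases Int.even_or_odd a₁.x with hx | hx
  · exact Or.inl ((thetaSecant_reach_iff_even_fundamental_x hd h).2 hx)
  · right
    obtain ⟨a, b, u, v, hab, ha, hb, hc⟩ := pell_certificate_of_odd_fundamental_x ((Int.odd_coe_nat d).2 hd) h hx
    have hb0 : (0 : ℤ) < b := by linarith
    refine ⟨a.natAbs, b.natAbs, u.natAbs, v.natAbs, ?_, ?_, ?_⟩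
    · have : ((a.natAbs * b.natAbs : ℕ) : ℤ) = (d : ℤ) := by push_cast; rw [abs_of_pos ha, abs_of_pos hb0, hab]
      exact_mod_cast this
    · have : (1 : ℤ) < (b.natAbs : ℤ) := by rw [Int.natCast_natAbs, abs_of_pos hb0]; exact hb
      exact_mod_cast this
    · have : ((b.natAbs * v.natAbs ^ 2 : ℕ) : ℤ) = ((a.natAbs * u.natAbs ^ 2 + 1 : ℕ) : ℤ) := by
        push_cast
        rw [abs_of_pos ha, abs_of_pos hb0, sq_abs, sq_abs]
        linarith
      exact_mod_cast this

/-- **REACH ⟺ NO CERTIFICATE** (odd non-square `d`): exactly one of the two finite certificates exists. [bookkeeping] -/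
theorem thetaSecant_reach_iff_no_certificate {d : ℕ} (hd : Odd d) (hsq : ¬ IsSquare d) :
    (∃ m k : ℕ, Even m ∧ m ^ 2 = d * k ^ 2 + 1) ↔ ¬ ∃ a b u v : ℕ, a * b = d ∧ 1 < b ∧ b * v ^ 2 = a * u ^ 2 + 1 := by
  constructor
  · rintro ⟨m, k, hm, hmk⟩ ⟨a, b, u, v, hab, hb, hcert⟩
    exact (thetaSecant_noReach_of_certificate hd hab hb hcert hmk).1 hm
  · intro hno
    exact (thetaSecant_reach_or_certificate hd hsq).resolve_right hno

/-- Squares are `≡ 0, 1 (mod 4)`: `d ≡ 3 (mod 4)` is not a square. [bookkeeping] -/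
theorem not_isSquare_of_mod_four_eq_three {d : ℕ} (hd : d % 4 = 3) : ¬ IsSquare d := by
  rintro ⟨r, hr⟩
  have h3 : r * r % 4 = 3 := by rw [← hr]; exact hd
  have h := Nat.mul_mod r r 4
  rcases (by omega : r % 4 = 0 ∨ r % 4 = 1 ∨ r % 4 = 2 ∨ r % 4 = 3) with h4 | h4 | h4 | h4 <;>
    simp [h4] at h <;> omega

/-- **REACH ⟺ NO CERTIFICATE for every `d ≡ 3 (mod 4)`** (odd and non-square automatically) — the cell's case («`d ≡ 3 (4)` squarefree»).
[bookkeeping] -/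
theorem thetaSecant_reach_iff_no_certificate_of_mod_four_eq_three {d : ℕ} (hd : d % 4 = 3) :
    (∃ m k : ℕ, Even m ∧ m ^ 2 = d * k ^ 2 + 1) ↔ ¬ ∃ a b u v : ℕ, a * b = d ∧ 1 < b ∧ b * v ^ 2 = a * u ^ 2 + 1 :=
  thetaSecant_reach_iff_no_certificate (Nat.odd_iff.2 (Nat.odd_of_mod_four_eq_three hd)) (not_isSquare_of_mod_four_eq_three hd)

/-- **Primes `p ≡ 3 (mod 4)` admit NO certificate** (the predecessor's `thetaSecant_reaches_prime` + exclusivity; directly: `a·b = p`, `1 < b` forces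
`b = p`, `a = 1`, `u² ≡ -1 (mod p)`). [bookkeeping] -/
theorem thetaSecant_no_certificate_of_prime {p : ℕ} (hp : p.Prime) (hp4 : p % 4 = 3) :
    ¬ ∃ a b u v : ℕ, a * b = p ∧ 1 < b ∧ b * v ^ 2 = a * u ^ 2 + 1 := by
  obtain ⟨m, k, hm, -, hmk⟩ := thetaSecant_reaches_prime hp hp4
  exact (thetaSecant_reach_iff_no_certificate_of_mod_four_eq_three hp4).1 ⟨m, k, hm, hmk⟩

/-! ## §3 The table by certificate, extended to `d < 200` -/

/-- **NO certificates** `(d, a, b, u, v)` with `a·b = d`, `1 < b`, `b·v² = a·u² + 1`: the predecessor's NO-list `39, 55, 95, 111` and the two new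
values `155, 183` below `200`. [bookkeeping] -/
theorem thetaSecant_noCertificate_table :
    ∀ t ∈ ([(39, 3, 13, 2, 1), (55, 11, 5, 2, 3), (95, 19, 5, 1, 2), (111, 3, 37, 7, 2), (155, 31, 5, 2, 5), (183, 3, 61, 9, 2)] :
      List (ℕ × ℕ × ℕ × ℕ × ℕ)),
      t.2.1 * t.2.2.1 = t.1 ∧ 1 < t.2.2.1 ∧ t.2.2.1 * t.2.2.2.2 ^ 2 = t.2.1 * t.2.2.2.1 ^ 2 + 1 := by
  decide

/-- **The NO-list by certificate, `d < 200`**: for `d ∈ {39, 55, 95, 111, 155, 183}` no even `m` has `m² = d·k² + 1` (and every such `k` is even) —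
`ℚ(√-d)` is not reached by any theta-secant parameter. One line per `d` (cf. the predecessor's `interval_cases` proofs for the first four).
[bookkeeping] -/
theorem thetaSecant_noList_by_certificate (d : ℕ) (hd : d ∈ ([39, 55, 95, 111, 155, 183] : List ℕ)) {m k : ℕ}
    (hmk : m ^ 2 = d * k ^ 2 + 1) : ¬ Even m ∧ Even k := by
  simp only [List.mem_cons, List.mem_nil_iff, or_false] at hd
  rcases hd with rfl | rfl | rfl | rfl | rfl | rfl
  · exact thetaSecant_noReach_of_certificate (a := 3) (b := 13) (u := 2) (v := 1) (Nat.odd_iff.2 rfl) rfl (by norm_num) rfl hmk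
  · exact thetaSecant_noReach_of_certificate (a := 11) (b := 5) (u := 2) (v := 3) (Nat.odd_iff.2 rfl) rfl (by norm_num) rfl hmk
  · exact thetaSecant_noReach_of_certificate (a := 19) (b := 5) (u := 1) (v := 2) (Nat.odd_iff.2 rfl) rfl (by norm_num) rfl hmk
  · exact thetaSecant_noReach_of_certificate (a := 3) (b := 37) (u := 7) (v := 2) (Nat.odd_iff.2 rfl) rfl (by norm_num) rfl hmk
  · exact thetaSecant_noReach_of_certificate (a := 31) (b := 5) (u := 2) (v := 5) (Nat.odd_iff.2 rfl) rfl (by norm_num) rfl hmk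
  · exact thetaSecant_noReach_of_certificate (a := 3) (b := 61) (u := 9) (v := 2) (Nat.odd_iff.2 rfl) rfl (by norm_num) rfl hmk

/-- **YES witnesses for the COMPOSITE squarefree `d ≡ 3 (mod 4)`, `119 < d < 200`** (the primes `127, …, 199` need none, `thetaSecant_reaches_prime`):
`(d, m, k)` with `m` even, `k` odd, `m² = d·k² + 1` for `d = 123, 143, 159, 187, 195`. With `thetaSecant_noList_by_certificate` (`155, 183` NO) this
completes the reach table of squarefree `d ≡ 3 (mod 4)` below `200`: NOT reached exactly for `d ∈ {39, 55, 95, 111, 155, 183}`. [bookkeeping] -/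
theorem thetaSecant_yesList_composite_lt_200 :
    ∀ t ∈ ([(123, 122, 11), (143, 12, 1), (159, 1324, 105), (187, 1682, 123), (195, 14, 1)] : List (ℕ × ℕ × ℕ)),
      t.2.1 % 2 = 0 ∧ t.2.2 % 2 = 1 ∧ t.2.1 ^ 2 = t.1 * t.2.2 ^ 2 + 1 := by
  decide

/-- **«prime» is load-bearing in `pell_even_x_of_isFundamental_of_prime`**: the composite `d = 39 ≡ 3 (mod 4)` has fundamental solution `(25, 4)`
with `x` ODD (fundamentality from the predecessor's non-square witnesses `pell_noSmaller_39`). [bookkeeping] -/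
theorem pell_fundamental_x_odd_39 : ∃ a₁ : Solution₁ 39, IsFundamental a₁ ∧ Odd a₁.x :=
  ⟨Solution₁.mk 25 4 (by norm_num),
    pell_isFundamental_of_noSmaller (d := 39) (Solution₁.mk 25 4 (by norm_num)) (by rw [Solution₁.x_mk]; norm_num) (y₁ := 4)
      (by rw [Solution₁.y_mk]; rfl) (by norm_num) pell_noSmaller_39,
    by rw [Solution₁.x_mk]; exact ⟨12, by norm_num⟩⟩

/-- Hence «`d ≡ 3 (mod 4)` ⟹ fundamental `x` even» is FALSE without primality (negative control, in the kernel). [bookkeeping] -/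
theorem not_forall_mod_four_eq_three_fundamental_x_even :
    ¬ ∀ d : ℕ, d % 4 = 3 → ∀ a₁ : Solution₁ (d : ℤ), IsFundamental a₁ → Even a₁.x := by
  intro h
  obtain ⟨a₁, h₁, hodd⟩ := pell_fundamental_x_odd_39
  exact Int.not_even_iff_odd.2 hodd (h 39 (by norm_num) a₁ h₁)

end PellDescent

/-! ## Audit: nothing is decided here
KERNEL: §1 the 2-descent both ways (odd fundamental `x` ⟺ certificate), §2 NO-by-certificate / dichotomy / reach ⟺ no certificate in the cell's
ℕ-currency, §3 six NO certificates and five YES witnesses (`decide`). No named hypothesis, no Weil-class statement: compose with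
`MethodInstanceG6ThetaSecantReachLaw.lean` §5 / `MethodInstanceG6ThetaSecantReach.lean` §3 for those (their tier: reach + PerfectComplexRankTransfer
BY NAME, m-uniform seed BY VALUE). Not here: any non-split sixfold, HC_CM, `σ ∘ ob = ⌟ch`. -/

end Summit.Ventures.HSemireg

end
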